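import Summits.CriticalPhenomena.PercolationContinuityZ3.Theorems.PercNearOneGluingNoHeavyRsw3WMSFOrientation
import HarnessLib

/-!
# RSW3 lane (P2, gen 30): THE WIRED MINIMAL SPANNING FOREST, II — THE TRUNK OF AN ORIENTED FOREST (deterministic)

builds on p205010 (kernel theorem, internal audit signed; external expert review pending) — NOT used in this file.

Cell `prim-rsw3`, prover seat `prim-rsw3-p2` (gen 30), memo `run/shared/lean/prim/rsw3/P2-RSWLITE.md` §37.  Support file
(`--supports stmt-CriticalPhenomena-4575`); no definitions, no named facts, no sorries.  Second file of the programme "every component of `𝔉_w(ℤ^d)` has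
EXACTLY ONE end" (Lyons–Peres 2016 Thm. 11.12).  Everything here is DETERMINISTIC graph theory about an ACYCLIC graph `F` equipped with a RAY FIELD
`R : V → ℕ → V` — `R v` a self-avoiding `F`-ray from `v` — which is COHERENT (`R (R v i) k = R v (i + k)`) and whose rays SHARE TAILS along `F`
(file I shows that the backbones of `𝔉_w(ℤ^d)` are such a field, a.s.).  Write `par v := R v 1` (the parent), "`u` descends from `w`" for `∃ i, R u i = w`,
and call `w` a TRUNK vertex when infinitely many vertices descend from it (`{u | ∃ i, R u i = w}.Infinite`).

* §1 `parent_or_parent_of_adj` / `not_parent_and_parent_of_adj`: across an `F`-bond exactly one endpoint is the other's parent.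
* §2 descendants: `desc_of_desc_ray` (descent is inherited by ancestors), `infinite_desc_ray` (ancestors of trunk vertices are trunk),
  `exists_trunk_child` (a trunk vertex has a trunk child — `F` locally finite).
* §3 **`trunk_chain_of_ray`** — A NON-CANONICAL RAY FORCES A DESCENDING TRUNK CHAIN: if `ρ` is a self-avoiding `F`-ray from `v` with `ρ ≠ R v`, then from the
  last index `j` of agreement on, `par (ρ (n+1)) = ρ n` and every `ρ n` (`n ≥ j`) is a trunk vertex descending to `ρ j = R v j`.  So: NO TRUNK ⇒ ONE END
  (`ray_eq_of_trunk_empty`).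
* §4 under NO BRANCHING (every vertex has at most one trunk child): trunk vertices of one component are totally ordered by ancestry
  (`ancestor_or_ancestor`), and for a level `t` at most one trunk vertex `w` of a component has `U(w, par w) > t ≥ U(par^i w, par^{i+1} w)` for all `i ≥ 1`
  (`marked_unique`); such a MARKED vertex exists above any trunk vertex whose parent bond has label `> t` once the labels up its ray are eventually `≤ t`
  (`exists_marked`).  These are the two inputs of the mass-transport steps (files III–IV): no branching a.s., then no marked vertex a.s., hence no trunk.

References: R. Lyons, Y. Peres, *Probability on Trees and Networks* (2016), Thm. 11.12 (proof: trunk, orientation toward the special end, the last edge with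
label `> p_c + ε`) [LyonsPeres2016]; R. Lyons, Y. Peres, O. Schramm, Ann. Probab. 34 (2006) Thm. 3.12 [LyonsPeresSchramm2006].
-/

noncomputable section

namespace Summit.CriticalPhenomena.PercolationContinuityZ3.Theorems.Rsw3

open Filter

section Trunk

variable {V : Type*} {F : SimpleGraph V} {R : V → ℕ → V}

/-! ## §1 The parent relation across a bond -/

/-- **Across an `F`-bond one endpoint is the other's parent** (`F` acyclic; `R` self-avoiding `F`-rays from each vertex, sharing tails across bonds): for `F.Adj x y`,
`R x 1 = y` or `R y 1 = x`. [cite: LyonsPeres2016, Thm. 11.12 (proof: orientation toward the special end)] -/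
theorem parent_or_parent_of_adj (hF : F.IsAcyclic) (h0 : ∀ v, R v 0 = v) (hinj : ∀ v, Function.Injective (R v))
    (hadj : ∀ v i, F.Adj (R v i) (R v (i + 1))) {x y : V} (hxy : F.Adj x y) (htail : ∃ a b, ∀ k, R x (a + k) = R y (b + k)) :
    R x 1 = y ∨ R y 1 = x := by
  classical
  by_cases hv : ∃ i, R y i = x
  · obtain ⟨i, hi⟩ := hv
    right
    have hi0 : i ≠ 0 := fun h => hxy.ne (by rw [h, h0] at hi; exact hi.symm)
    obtain ⟨p, hp⟩ := exists_walk_support_eq (R y) (hadj y) i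
    let pF : F.Walk y x := p.copy (h0 y) hi
    have hpF : pF.IsPath := by
      rw [SimpleGraph.Walk.isPath_def, SimpleGraph.Walk.support_copy, hp]
      exact (List.nodup_range).map (hinj y)
    let q : F.Walk y x := SimpleGraph.Walk.cons hxy.symm SimpleGraph.Walk.nil
    have hq : q.IsPath :=
      SimpleGraph.Walk.IsPath.nil.cons (by rw [SimpleGraph.Walk.support_nil, List.mem_singleton]; exact hxy.ne.symm)
    have hpq : (⟨pF, hpF⟩ : F.Path y x) = ⟨q, hq⟩ := hF.path_unique _ _
    have hlen : pF.length = q.length := by rw [show pF = q from congrArg Subtype.val hpq]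
    have hi1 : i = 1 := by
      have h1 : pF.length = i := by
        rw [SimpleGraph.Walk.length_copy]
        have := congrArg List.length hp
        rw [SimpleGraph.Walk.length_support, List.length_map, List.length_range] at this
        omega
      have h2 : q.length = 1 := rfl
      omega
    rw [hi1] at hi
    exact hi
  · left
    have hv' : ∀ i, R y i ≠ x := fun i h => hv ⟨i, h⟩
    let σ : ℕ → V := fun k => Nat.casesOn k x fun j => R y j
    have hσ0 : σ 0 = x := rfl
    have hσs : ∀ j, σ (j + 1) = R y j := fun j => rfl
    have hσinj : Function.Injective σ := by
      intro i j hij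
      cases i with
      | zero =>
        cases j with
        | zero => rfl
        | succ j => exact absurd (hij.symm.trans hσ0) (hv' j)
      | succ i =>
        cases j with
        | zero => exact absurd (hij.trans hσ0) (hv' i)
        | succ j => rw [hσs, hσs] at hij; rw [hinj y hij]
    have hσadj : ∀ k, F.Adj (σ k) (σ (k + 1)) := by
      intro k
      cases k with
      | zero => rw [hσ0, hσs, h0]; exact hxy
      | succ j => rw [hσs, hσs]; exact hadj y j
    obtain ⟨a, b, hab⟩ := htail
    have h := ray_eq_of_tail_shared hF 1 hσinj (hinj x) hσadj (hadj x) (hσ0.trans (h0 x).symm) (b + 1) a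
      (fun k => by rw [show b + 1 + k = (b + k) + 1 by omega, hσs, hab k])
    rw [show σ 1 = R y 0 from rfl, h0] at h
    exact h.symm

/-- … and not both (coherence and injectivity: `R x 2 = R (R x 1) 1 = R y 1 = x = R x 0` is impossible). [cite: LyonsPeres2016, Thm. 11.12 (proof)] -/
theorem not_parent_and_parent_of_adj (h0 : ∀ v, R v 0 = v) (hinj : ∀ v, Function.Injective (R v))
    (hcoh : ∀ v i k, R (R v i) k = R v (i + k)) {x y : V} : ¬ (R x 1 = y ∧ R y 1 = x) := by
  rintro ⟨h1, h2⟩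
  have : R x (1 + 1) = R x 0 := by rw [← hcoh x 1 1, h1, h2, h0]
  exact absurd (hinj x this) (by omega)

/-! ## §2 Descendants and trunk vertices -/

/-- Descent is inherited by ancestors: if `u` descends from `w` then `u` descends from every `R w m`. [cite: LyonsPeres2016, Thm. 11.12 (proof: the trunk)] -/
theorem desc_of_desc_ray (hcoh : ∀ v i k, R (R v i) k = R v (i + k)) {u w : V} (h : ∃ i, R u i = w) (m : ℕ) : ∃ i, R u i = R w m := by
  obtain ⟨i, hi⟩ := h
  exact ⟨i + m, by rw [← hi, hcoh u i m]⟩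

/-- **Ancestors of trunk vertices are trunk vertices.** [cite: LyonsPeres2016, Thm. 11.12 (proof: the trunk)] -/
theorem infinite_desc_ray (hcoh : ∀ v i k, R (R v i) k = R v (i + k)) {w : V} (h : {u | ∃ i, R u i = w}.Infinite) (m : ℕ) :
    {u | ∃ i, R u i = R w m}.Infinite :=
  h.mono fun _ hu => desc_of_desc_ray hcoh hu m

/-- A vertex descending from `o` other than `o` descends from a CHILD of `o` (a neighbour `w` with `R w 1 = o`). [cite: LyonsPeres2016, Thm. 11.12 (proof)] -/
theorem exists_child_of_desc (h0 : ∀ v, R v 0 = v) (hadj : ∀ v i, F.Adj (R v i) (R v (i + 1))) (hcoh : ∀ v i k, R (R v i) k = R v (i + k))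
    {u o : V} (h : ∃ i, R u i = o) (hne : u ≠ o) : ∃ w, F.Adj w o ∧ R w 1 = o ∧ ∃ i, R u i = w := by
  obtain ⟨i, hi⟩ := h
  have hi0 : i ≠ 0 := fun h => hne (by rw [h, h0] at hi; exact hi)
  obtain ⟨i, rfl⟩ : ∃ i', i = i' + 1 := ⟨i - 1, by omega⟩
  refine ⟨R u i, ?_, ?_, ⟨i, rfl⟩⟩
  · have := hadj u i; rwa [hi] at this
  · rw [hcoh u i 1, hi]

/-- **A trunk vertex has a trunk child** (`F` locally finite): its infinitely many proper descendants descend from its finitely many children.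
[cite: LyonsPeres2016, Thm. 11.12 (proof: the trunk)] -/
theorem exists_trunk_child [DecidableEq V] [F.LocallyFinite] (h0 : ∀ v, R v 0 = v) (hadj : ∀ v i, F.Adj (R v i) (R v (i + 1)))
    (hcoh : ∀ v i k, R (R v i) k = R v (i + k)) {o : V} (h : {u | ∃ i, R u i = o}.Infinite) :
    ∃ w, F.Adj w o ∧ R w 1 = o ∧ {u | ∃ i, R u i = w}.Infinite := by
  classical
  by_contra hcon
  apply h
  have hsub : {u | ∃ i, R u i = o} ⊆ {o} ∪ ⋃ w ∈ ((F.neighborFinset o).filter fun w => R w 1 = o), {u | ∃ i, R u i = w} := by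
    intro u hu
    by_cases huo : u = o
    · exact Or.inl huo
    · obtain ⟨w, hwo, hw1, hw⟩ := exists_child_of_desc h0 hadj hcoh hu huo
      refine Or.inr (Set.mem_biUnion (x := w) ?_ hw)
      simp only [Finset.coe_filter, SimpleGraph.mem_neighborFinset, Set.mem_setOf_eq]
      exact ⟨hwo.symm, hw1⟩
  refine Set.Finite.subset (Set.Finite.union (Set.finite_singleton o) ?_) hsub
  refine Set.Finite.biUnion (Finset.finite_toSet _) fun w hw => ?_
  simp only [Finset.coe_filter, SimpleGraph.mem_neighborFinset, Set.mem_setOf_eq] at hw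
  by_contra hinf
  exact hcon ⟨w, hw.1.symm, hw.2, hinf⟩

/-! ## §3 A non-canonical ray forces a descending trunk chain; no trunk ⇒ one end -/

/-- Along a self-avoiding `F`-ray `ρ`, once `par (ρ (n₀+1)) = ρ n₀` the orientation propagates down the ray: `par (ρ (n+1)) = ρ n` for all `n ≥ n₀`.
[cite: LyonsPeres2016, Thm. 11.12 (proof)] -/
theorem parent_chain (hF : F.IsAcyclic) (h0 : ∀ v, R v 0 = v) (hinj : ∀ v, Function.Injective (R v))
    (hadj : ∀ v i, F.Adj (R v i) (R v (i + 1))) (htail : ∀ x y, F.Adj x y → ∃ a b, ∀ k, R x (a + k) = R y (b + k))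
    {ρ : ℕ → V} (hρ : Function.Injective ρ) (hρadj : ∀ i, F.Adj (ρ i) (ρ (i + 1))) {n₀ : ℕ} (hn₀ : R (ρ (n₀ + 1)) 1 = ρ n₀) :
    ∀ n, n₀ ≤ n → R (ρ (n + 1)) 1 = ρ n := by
  intro n hn
  induction n, hn using Nat.le_induction with
  | base => exact hn₀
  | succ n hn ih =>
    rcases parent_or_parent_of_adj hF h0 hinj hadj (hρadj (n + 1)) (htail _ _ (hρadj (n + 1))) with h | h
    · exact absurd (ih.symm.trans h) fun heq => by have := hρ heq; omega
    · exact h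

/-- Down a parent chain every later vertex descends from every earlier one: `R (ρ m) (m - n) = ρ n` for `n₀ ≤ n ≤ m`. [cite: LyonsPeres2016, Thm. 11.12 (proof)] -/
theorem desc_along_chain (hcoh : ∀ v i k, R (R v i) k = R v (i + k)) (h0 : ∀ v, R v 0 = v) {ρ : ℕ → V} {n₀ : ℕ}
    (hpar : ∀ n, n₀ ≤ n → R (ρ (n + 1)) 1 = ρ n) {n m : ℕ} (hn : n₀ ≤ n) (hm : n ≤ m) : R (ρ m) (m - n) = ρ n := by
  induction m, hm using Nat.le_induction with
  | base => rw [Nat.sub_self, h0]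
  | succ m hm ih =>
    rw [show m + 1 - n = 1 + (m - n) by omega, ← hcoh (ρ (m + 1)) 1 (m - n), hpar m (hn.trans hm), ih]

/-- **A NON-CANONICAL RAY FORCES A DESCENDING TRUNK CHAIN**: if `ρ` is a self-avoiding `F`-ray from `v` different from `R v`, there is an index `j` with
`ρ j = R v j` such that for every `n ≥ j`: `par (ρ (n+1)) = ρ n`, `ρ n` descends to `ρ j`, and `ρ n` is a TRUNK vertex.
[cite: LyonsPeres2016, Thm. 11.12 (proof: a component with two ends contains a trunk)] -/
theorem trunk_chain_of_ray (hF : F.IsAcyclic) (h0 : ∀ v, R v 0 = v) (hinj : ∀ v, Function.Injective (R v))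
    (hadj : ∀ v i, F.Adj (R v i) (R v (i + 1))) (hcoh : ∀ v i k, R (R v i) k = R v (i + k))
    (htail : ∀ x y, F.Adj x y → ∃ a b, ∀ k, R x (a + k) = R y (b + k))
    {v : V} {ρ : ℕ → V} (hρ : Function.Injective ρ) (hρ0 : ρ 0 = v) (hρadj : ∀ i, F.Adj (ρ i) (ρ (i + 1))) (hne : ρ ≠ R v) :
    ∃ j, ρ j = R v j ∧ ∀ n, j ≤ n →
      R (ρ (n + 1)) 1 = ρ n ∧ (∃ i, R (ρ n) i = ρ j) ∧ {u | ∃ i, R u i = ρ n}.Infinite := by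
  classical
  have hex : ∃ i, ρ i ≠ R v i := by
    by_contra h
    exact hne (funext fun i => by by_contra hi; exact h ⟨i, hi⟩)
  let m := Nat.find hex
  have hm : ρ m ≠ R v m := Nat.find_spec hex
  have hm0 : m ≠ 0 := fun h => by rw [h] at hm; exact hm (hρ0.trans (h0 v).symm)
  obtain ⟨j, hj⟩ : ∃ j, m = j + 1 := ⟨m - 1, by omega⟩
  have hjagree : ρ j = R v j := by
    have := Nat.find_min hex (show j < m by omega)
    simpa using this
  -- the orientation at the branching bond `{ρ j, ρ (j+1)}`: `ρ (j+1) ≠ R v (j+1) = par (ρ j)`, so `par (ρ (j+1)) = ρ j`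
  have hstart : R (ρ (j + 1)) 1 = ρ j := by
    rcases parent_or_parent_of_adj hF h0 hinj hadj (hρadj j) (htail _ _ (hρadj j)) with h | h
    · exfalso
      rw [hjagree, hcoh v j 1] at h
      rw [hj] at hm
      exact hm h.symm
    · exact h
  have hchain := parent_chain hF h0 hinj hadj htail hρ hρadj hstart
  refine ⟨j, hjagree, fun n hn => ⟨hchain n hn, ⟨n - j, desc_along_chain hcoh h0 hchain le_rfl hn⟩, ?_⟩⟩
  -- every `ρ m`, `m ≥ n`, descends from `ρ n`
  have hsub : ρ '' {m' | n ≤ m'} ⊆ {u | ∃ i, R u i = ρ n} := by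
    rintro _ ⟨m', hm', rfl⟩
    exact ⟨m' - n, desc_along_chain hcoh h0 hchain hn hm'⟩
  exact ((Set.Ici_infinite n).image hρ.injOn).mono hsub

/-- **NO TRUNK ⇒ ONE END**: if no vertex of `F` is a trunk vertex, every self-avoiding `F`-ray from `v` IS the canonical ray `R v`.
[cite: LyonsPeres2016, Thm. 11.12 (proof: "all components have only one end")] -/
theorem ray_eq_of_trunk_empty (hF : F.IsAcyclic) (h0 : ∀ v, R v 0 = v) (hinj : ∀ v, Function.Injective (R v))
    (hadj : ∀ v i, F.Adj (R v i) (R v (i + 1))) (hcoh : ∀ v i k, R (R v i) k = R v (i + k))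
    (htail : ∀ x y, F.Adj x y → ∃ a b, ∀ k, R x (a + k) = R y (b + k))
    (hno : ∀ w : V, {u | ∃ i, R u i = w}.Finite)
    {v : V} {ρ : ℕ → V} (hρ : Function.Injective ρ) (hρ0 : ρ 0 = v) (hρadj : ∀ i, F.Adj (ρ i) (ρ (i + 1))) : ρ = R v := by
  by_contra hne
  obtain ⟨j, -, hj⟩ := trunk_chain_of_ray hF h0 hinj hadj hcoh htail hρ hρ0 hρadj hne
  exact (hj j le_rfl).2.2 (hno _)

/-! ## §4 No branching: total order of the trunk and marked vertices -/

/-- **Under NO BRANCHING, trunk vertices sharing a tail are comparable**: one is an ancestor of the other (at the merging point two distinct trunk children would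
appear). [cite: LyonsPeres2016, Thm. 11.12 (proof: the trunk is a single bi-infinite path)] -/
theorem ancestor_or_ancestor (h0 : ∀ v, R v 0 = v) (hcoh : ∀ v i k, R (R v i) k = R v (i + k))
    (hnb : ∀ m w₁ w₂ : V, R w₁ 1 = m → R w₂ 1 = m → {u | ∃ i, R u i = w₁}.Infinite → {u | ∃ i, R u i = w₂}.Infinite → w₁ = w₂)
    {z z' : V} (hz : {u | ∃ i, R u i = z}.Infinite) (hz' : {u | ∃ i, R u i = z'}.Infinite) (htail : ∃ a b, ∀ k, R z (a + k) = R z' (b + k)) :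
    (∃ i, R z i = z') ∨ (∃ i, R z' i = z) := by
  classical
  have hex : ∃ a, ∃ b, ∀ k, R z (a + k) = R z' (b + k) := htail
  -- minimal merging index on the side of `z`
  set a := Nat.find hex with ha
  obtain ⟨b, hb⟩ : ∃ b, ∀ k, R z (a + k) = R z' (b + k) := Nat.find_spec hex
  rcases Nat.eq_zero_or_pos a with ha0 | ha0
  · right
    refine ⟨b, ?_⟩
    have := hb 0
    rw [ha0, Nat.add_zero, h0, Nat.add_zero] at this
    exact this.symm
  rcases Nat.eq_zero_or_pos b with hb0 | hb0
  · left
    refine ⟨a, ?_⟩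
    have := hb 0
    rw [hb0, Nat.add_zero, Nat.add_zero, h0] at this
    exact this
  by_cases heq : R z (a - 1) = R z' (b - 1)
  · -- then `(a - 1, b - 1)` is already a merging pair, contradicting minimality
    exfalso
    have hmerge : ∃ b', ∀ k, R z (a - 1 + k) = R z' (b' + k) := by
      refine ⟨b - 1, fun k => ?_⟩
      rcases Nat.eq_zero_or_pos k with rfl | hk
      · simpa using heq
      · have := hb (k - 1)
        rw [show a + (k - 1) = a - 1 + k by omega, show b + (k - 1) = b - 1 + k by omega] at this
        exact this
    have := Nat.find_min hex (show a - 1 < a by omega)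
    exact this hmerge
  · -- two distinct trunk children of the merging point
    exfalso
    have h1 : R (R z (a - 1)) 1 = R z a := by rw [hcoh, show a - 1 + 1 = a by omega]
    have h2 : R (R z' (b - 1)) 1 = R z a := by
      rw [hcoh, show b - 1 + 1 = b by omega]
      have := hb 0
      rw [Nat.add_zero, Nat.add_zero] at this
      exact this.symm
    exact heq (hnb _ _ _ h1 h2 (infinite_desc_ray hcoh hz _) (infinite_desc_ray hcoh hz' _))

/-- **At most one MARKED trunk vertex per component under no branching**: with bond labels `U` and a level `t`, call a trunk vertex `w` marked when
`U s(w, par w) > t` while `U s(par^i w, par^{i+1} w) ≤ t` for all `i ≥ 1`; two marked trunk vertices sharing a tail coincide (they are comparable, and the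
lower one's condition contradicts the upper one's mark). [cite: LyonsPeres2016, Thm. 11.12 (proof: "a largest m such that U([x_m, x_{m+1}]) > p_c + ε")] -/
theorem marked_unique (h0 : ∀ v, R v 0 = v) (hcoh : ∀ v i k, R (R v i) k = R v (i + k))
    (hnb : ∀ m w₁ w₂ : V, R w₁ 1 = m → R w₂ 1 = m → {u | ∃ i, R u i = w₁}.Infinite → {u | ∃ i, R u i = w₂}.Infinite → w₁ = w₂)
    {U : Sym2 V → ℝ} {t : ℝ} {w w' : V}
    (hw : {u | ∃ i, R u i = w}.Infinite) (hwt : t < U s(w, R w 1)) (hwup : ∀ i, 1 ≤ i → U s(R w i, R w (i + 1)) ≤ t)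
    (hw' : {u | ∃ i, R u i = w'}.Infinite) (hw't : t < U s(w', R w' 1)) (hw'up : ∀ i, 1 ≤ i → U s(R w' i, R w' (i + 1)) ≤ t)
    (htail : ∃ a b, ∀ k, R w (a + k) = R w' (b + k)) : w = w' := by
  rcases ancestor_or_ancestor h0 hcoh hnb hw hw' htail with ⟨i, hi⟩ | ⟨i, hi⟩
  · rcases Nat.eq_zero_or_pos i with rfl | hi0
    · rw [h0] at hi; exact hi
    · exfalso
      have h := hwup i hi0
      rw [hi, ← hcoh w i 1, hi] at h
      exact absurd hw't (not_lt.2 h)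
  · rcases Nat.eq_zero_or_pos i with rfl | hi0
    · rw [h0] at hi; exact hi.symm
    · exfalso
      have h := hw'up i hi0
      rw [hi, ← hcoh w' i 1, hi] at h
      exact absurd hwt (not_lt.2 h)

/-- **A marked vertex exists above every trunk vertex whose parent bond has label `> t`, once the labels up its ray are eventually `≤ t`**: the last index `i`
with `U s(R z i, R z (i+1)) > t` gives the marked ancestor `R z i`. [cite: LyonsPeres2016, Thm. 11.12 (proof: "there is a largest m such that …")] -/
theorem exists_marked (hcoh : ∀ v i k, R (R v i) k = R v (i + k)) {U : Sym2 V → ℝ} {t : ℝ} {z : V}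
    (hz : {u | ∃ i, R u i = z}.Infinite) (hzt : t < U s(R z 0, R z 1)) (hev : ∀ᶠ i in atTop, U s(R z i, R z (i + 1)) ≤ t) :
    ∃ w, (∃ i, R z i = w) ∧ {u | ∃ i, R u i = w}.Infinite ∧ t < U s(w, R w 1) ∧ ∀ i, 1 ≤ i → U s(R w i, R w (i + 1)) ≤ t := by
  classical
  obtain ⟨N, hN⟩ := eventually_atTop.1 hev
  let S : Finset ℕ := (Finset.range N).filter fun i => t < U s(R z i, R z (i + 1))
  have hN0 : 0 < N := by
    by_contra h
    have := hN 0 (by omega)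
    exact absurd hzt (not_lt.2 this)
  have h0S : 0 ∈ S := by
    simp only [S, Finset.mem_filter, Finset.mem_range]
    exact ⟨hN0, hzt⟩
  set i₀ := S.max' ⟨0, h0S⟩ with hi₀
  have hi₀S : i₀ ∈ S := S.max'_mem ⟨0, h0S⟩
  have hi₀t : t < U s(R z i₀, R z (i₀ + 1)) := by
    have := hi₀S
    simp only [S, Finset.mem_filter, Finset.mem_range] at this
    exact this.2
  have habove : ∀ i, i₀ < i → U s(R z i, R z (i + 1)) ≤ t := by
    intro i hi
    by_contra hgt
    rw [not_le] at hgt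
    rcases lt_or_ge i N with hiN | hiN
    · have hiS : i ∈ S := by
        simp only [S, Finset.mem_filter, Finset.mem_range]
        exact ⟨hiN, hgt⟩
      exact absurd (S.le_max' i hiS) (by rw [← hi₀]; exact not_le.2 hi)
    · exact absurd (hN i hiN) (not_le.2 hgt)
  refine ⟨R z i₀, ⟨i₀, rfl⟩, infinite_desc_ray hcoh hz i₀, by rwa [hcoh], fun i hi => ?_⟩
  rw [hcoh, hcoh, show i₀ + (i + 1) = i₀ + i + 1 by omega]
  exact habove (i₀ + i) (by omega)

end Trunk

end Summit.CriticalPhenomena.PercolationContinuityZ3.Theorems.Rsw3
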